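import Summits.QuantumFields.BalabanUV.T4Continuum.Spine.NE3.FrameNormalisationOneLevel
import HarnessLib

/-!
# T⁴ programme, node NE3 — census R50, ADMISSIBILITY of the zeroth-order frame gauge: subgroup membership (e.g. unitarity) and periodicity PROPAGATE from the top corner
# data down a hierarchically block-covariantly-constant gauge (`FrameNormalisationAdmissible`)

Cell `pub-balaban-gaps` (track G2, seat ne3, generation 11), row NE3; census `HOME/ne/NE3.md` §4 R50 (M4), §17.  `FrameNormalisation.exists_frameNormalised'` produces a gauge `v`
that is hierarchically block-covariantly constant (`R(Ū₀ⁱ(Γ_{Ly,Ly+r})) v_i(Ly+r) = v_i(Ly)`, `i < k`) with prescribed top corner data; THE END's `LandauRepB8Avg` wants the gauge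
`u = v·u₀` UNITARY (`IsUnitarySite`) and `(N·L^k)`-PERIODIC (`IsPeriodicSite`).  Both properties propagate from the top data by the same downward induction as the size letter
`FrameNormalisationSize.norm_sub_one_le_of_hier` — the level-`i` corner values are conjugates, by holonomies of `Ū₀ⁱ`, of the level-`(i+1)` ones:

* §1 **`mem_of_hier`** — if the averaged backgrounds `Ū₀ⁱ`, `i < k`, take values in a subgroup `G` (for `G = U(n)`: `B7Prop2Explicit.avgIter_mem` ∕ `B8Prop7AdmittedFamily.avgIter_mem_unitaryUnits`)
  and the top data `v(L^kz)` lie in `G`, then EVERY value `v(x)` lies in `G` (for the frame gauge the top data are `u₀(L^kz)⁻¹·v_k(U₀′)(z)`, unitary by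
  `B8Prop7AdmittedFamily.dbavgCovIter_vcov_mem_unitaryUnits` — not plugged here).
* §2 **`periodic_of_hier`** — if `Ū₀ⁱ` is `(N·L^{k−i})`-periodic for `i < k` (`avgIter` of an `(N·L^k)`-periodic `W`) and the top data are `N`-periodic on `Ω^{(k)}`, then `v` is
  `(N·L^k)`-periodic on the fine lattice.

HONEST FRAMING (page 1).  Bookkeeping about OUR objects (0 def, 0 sorry); the top-data facts (unitarity ∕ periodicity of `v_k(U₀′)`) are NOT plugged here; nothing of Bałaban's is
asserted; `PairLandauGaugeB8Avg`, the covariant root and **NE3 are NOT proved**; spine PROVED 0∕9; finite T⁴ rung (B)+1 — NOT continuum YM on ℝ⁴, NOT infinite volume, NOT mass gap, NOT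
`BetaPertH`, NOT Clay.  HONEST DEPENDENCY: continuum YM on T⁴ ⇐ BetaPertH ∧ nine spine estimates (0/9 proved); BetaPertH ⇐ (D1) ∧ (D4) ∧ CAP+tail; G-an2-4 gates asym, D1 and NE2/3/4.
PLACEMENT: `Summits/QuantumFields/BalabanUV/T4Continuum/Spine/NE3/`; imports `FrameNormalisationOneLevel` (block decomposition) only.
-/

set_option autoImplicit false

open scoped BigOperators Matrix Matrix.Norms.L2Operator
open NormedSpace

namespace Summit.QuantumFields.BalabanUV.T4Continuum.NE3.FrameNormalisationAdmissible

open Literature.MathematicalPhysics.QuantumFieldTheory.Balaban1983to89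
open B7Prop1Explicit B7Prop2Explicit
open B7AvgGaugeCovariance (uLev uLev_apply uLev_smul)
open B7Eq92Concrete (Rc Rc_apply Rc_inv_apply)
open NE3.FrameNormalisationOneLevel (site_eq_corner_add_boxVec)

noncomputable section

variable {d : ℕ} {n : Type*} [Fintype n] [DecidableEq n]

/-! ## §1 Subgroup membership propagates down the hierarchy -/

/-- **EVERY VALUE OF A HIERARCHICALLY BLOCK-COVARIANTLY-CONSTANT GAUGE LIES IN `G`** if the averaged backgrounds `Ū₀ⁱ` (`i < k`) are `G`-valued and the top corner data are
(`L ≥ 1`; downward induction: `v_i(Ly+r) = R(Ū₀ⁱ(Γ))⁻¹ v_{i+1}(y)`). [folklore] -/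
theorem mem_of_hier {L : ℕ} (hL : 1 ≤ L) (k : ℕ) (G : Subgroup (Matrix n n ℂ)ˣ) {W : Site d → Fin d → (Matrix n n ℂ)ˣ} {v : Site d → (Matrix n n ℂ)ˣ}
    (hWG : ∀ i < k, ∀ (x : Site d) (κ : Fin d), avgIter L W i x κ ∈ G)
    (hhier : ∀ i < k, ∀ (y : Site d) (r : Fin d → Fin L),
      Rc (hol (avgIter L W i) ((L : ℤ) • y) (treeWord (boxVec L r))) (uLev L v i ((L : ℤ) • y + boxVec L r)) = uLev L v i ((L : ℤ) • y))
    (htop : ∀ z : Site d, v (((L : ℤ) ^ k) • z) ∈ G) :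
    ∀ x : Site d, v x ∈ G := by
  have key : ∀ m : ℕ, m ≤ k → ∀ y : Site d, v (((L : ℤ) ^ (k - m)) • y) ∈ G := by
    intro m
    induction m with
    | zero => intro _ y; rw [Nat.sub_zero]; exact htop y
    | succ m ih =>
      intro hm y
      have hi : k - (m + 1) < k := by omega
      have hkm : k - m = k - (m + 1) + 1 := by omega
      obtain ⟨y₁, r, hy⟩ := site_eq_corner_add_boxVec (d := d) hL y
      have hc := hhier (k - (m + 1)) hi y₁ r
      have h1 : v (((L : ℤ) ^ (k - (m + 1))) • y) = uLev L v (k - (m + 1)) ((L : ℤ) • y₁ + boxVec L r) := by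
        rw [uLev_apply, hy]
      have h2 : uLev L v (k - (m + 1)) ((L : ℤ) • y₁) = v (((L : ℤ) ^ (k - m)) • y₁) := by
        rw [uLev_smul, uLev_apply, ← hkm]
      have h3 : uLev L v (k - (m + 1)) ((L : ℤ) • y₁ + boxVec L r)
          = Rc (hol (avgIter L W (k - (m + 1))) ((L : ℤ) • y₁) (treeWord (boxVec L r)))⁻¹ (v (((L : ℤ) ^ (k - m)) • y₁)) := by
        rw [← h2, ← hc, (Rc_inv_apply _ _).1]
      rw [h1, h3, Rc_apply]
      have hh : hol (avgIter L W (k - (m + 1))) ((L : ℤ) • y₁) (treeWord (boxVec L r)) ∈ G := hol_mem_of (hWG _ hi) _ _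
      exact G.mul_mem (G.mul_mem (G.inv_mem hh) (ih (by omega) y₁)) (by rw [inv_inv]; exact hh)
  intro x
  have h := key k le_rfl x
  rwa [Nat.sub_self, pow_zero, one_smul] at h

/-! ## §2 Periodicity propagates down the hierarchy -/

/-- **A HIERARCHICALLY BLOCK-COVARIANTLY-CONSTANT GAUGE WITH `N`-PERIODIC TOP DATA IS `(N·L^k)`-PERIODIC** when the level-`i` averaged background is `(N·L^{k−i})`-periodic for
every `i < k` (`L ≥ 1`): translating by `N·L^k e_j` on the fine lattice translates the level-`i` block label by `N·L^{k−i−1} e_j`, under which the holonomies of `Ū₀ⁱ` and (by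
induction) the level-`(i+1)` corner values are invariant. [folklore] -/
theorem periodic_of_hier {L : ℕ} (hL : 1 ≤ L) (k N : ℕ) {W : Site d → Fin d → (Matrix n n ℂ)ˣ} {v : Site d → (Matrix n n ℂ)ˣ}
    (hWP : ∀ i < k, ∀ (x : Site d) (κ : Fin d) (j : Fin d), avgIter L W i (x + ((N * L ^ (k - i) : ℕ) : ℤ) • e j) κ = avgIter L W i x κ)
    (hhier : ∀ i < k, ∀ (y : Site d) (r : Fin d → Fin L),
      Rc (hol (avgIter L W i) ((L : ℤ) • y) (treeWord (boxVec L r))) (uLev L v i ((L : ℤ) • y + boxVec L r)) = uLev L v i ((L : ℤ) • y))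
    (htop : ∀ (z : Site d) (j : Fin d), v (((L : ℤ) ^ k) • (z + (N : ℤ) • e j)) = v (((L : ℤ) ^ k) • z)) :
    ∀ (x : Site d) (j : Fin d), v (x + ((N * L ^ k : ℕ) : ℤ) • e j) = v x := by
  -- `P m`: periodicity of the level-`(k−m)` corner values under the level-`(k−m)` period `N·L^m`
  have key : ∀ m : ℕ, m ≤ k → ∀ (y : Site d) (j : Fin d),
      v (((L : ℤ) ^ (k - m)) • (y + ((N * L ^ m : ℕ) : ℤ) • e j)) = v (((L : ℤ) ^ (k - m)) • y) := by
    intro m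
    induction m with
    | zero =>
      intro _ y j
      rw [Nat.sub_zero, pow_zero, mul_one]
      exact htop y j
    | succ m ih =>
      intro hm y j
      have hi : k - (m + 1) < k := by omega
      have hkm : k - m = k - (m + 1) + 1 := by omega
      obtain ⟨y₁, r, hy⟩ := site_eq_corner_add_boxVec (d := d) hL y
      -- the shifted site has the same offset and the block label shifted by `N·L^m`
      have hy' : y + ((N * L ^ (m + 1) : ℕ) : ℤ) • e j = (L : ℤ) • (y₁ + ((N * L ^ m : ℕ) : ℤ) • e j) + boxVec L r := by
        rw [hy, smul_add, smul_smul]; push_cast; ring_nf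
      -- the level-`i` holonomy is invariant under the shift of the corner by `L • (N·L^m) e_j = (N·L^{k−i}) e_j`
      have hper : ∀ w : List (Letter d),
          hol (avgIter L W (k - (m + 1))) ((L : ℤ) • (y₁ + ((N * L ^ m : ℕ) : ℤ) • e j)) w
            = hol (avgIter L W (k - (m + 1))) ((L : ℤ) • y₁) w := by
        intro w
        have hshift : (L : ℤ) • (y₁ + ((N * L ^ m : ℕ) : ℤ) • e j) = (L : ℤ) • y₁ + ((N * L ^ (k - (k - (m + 1))) : ℕ) : ℤ) • e j := by
          have : k - (k - (m + 1)) = m + 1 := by omega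
          rw [this, smul_add, smul_smul]; push_cast; ring_nf
        rw [hshift]
        exact hol_shift_of_periodic (hWP _ hi) _ _ w
      have hc := hhier (k - (m + 1)) hi y₁ r
      have hc' := hhier (k - (m + 1)) hi (y₁ + ((N * L ^ m : ℕ) : ℤ) • e j) r
      have h2 : uLev L v (k - (m + 1)) ((L : ℤ) • y₁) = v (((L : ℤ) ^ (k - m)) • y₁) := by
        rw [uLev_smul, uLev_apply, ← hkm]
      have h2' : uLev L v (k - (m + 1)) ((L : ℤ) • (y₁ + ((N * L ^ m : ℕ) : ℤ) • e j)) = v (((L : ℤ) ^ (k - m)) • y₁) := by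
        rw [uLev_smul, uLev_apply, ← hkm]; exact ih (by omega) y₁ j
      have h3 : uLev L v (k - (m + 1)) ((L : ℤ) • y₁ + boxVec L r)
          = Rc (hol (avgIter L W (k - (m + 1))) ((L : ℤ) • y₁) (treeWord (boxVec L r)))⁻¹ (v (((L : ℤ) ^ (k - m)) • y₁)) := by
        rw [← h2, ← hc, (Rc_inv_apply _ _).1]
      have h3' : uLev L v (k - (m + 1)) ((L : ℤ) • (y₁ + ((N * L ^ m : ℕ) : ℤ) • e j) + boxVec L r)
          = Rc (hol (avgIter L W (k - (m + 1))) ((L : ℤ) • y₁) (treeWord (boxVec L r)))⁻¹ (v (((L : ℤ) ^ (k - m)) • y₁)) := by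
        rw [← h2', ← hper, ← hc', (Rc_inv_apply _ _).1]
      calc v (((L : ℤ) ^ (k - (m + 1))) • (y + ((N * L ^ (m + 1) : ℕ) : ℤ) • e j))
          = uLev L v (k - (m + 1)) ((L : ℤ) • (y₁ + ((N * L ^ m : ℕ) : ℤ) • e j) + boxVec L r) := by rw [uLev_apply, hy']
        _ = uLev L v (k - (m + 1)) ((L : ℤ) • y₁ + boxVec L r) := by rw [h3', h3]
        _ = v (((L : ℤ) ^ (k - (m + 1))) • y) := by rw [uLev_apply, hy]
  intro x j
  have h := key k le_rfl x j
  rwa [Nat.sub_self, pow_zero, one_smul, one_smul] at h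
where
  /-- holonomies of a `P`-periodic configuration are invariant under translating the base point by `P e_j` (cf. `ChainEndFix.hol_shift_of_invariant`). -/
  hol_shift_of_periodic {V : Site d → Fin d → (Matrix n n ℂ)ˣ} {P : ℕ}
      (hV : ∀ (x : Site d) (κ : Fin d) (j : Fin d), V (x + (P : ℤ) • e j) κ = V x κ) (x : Site d) (j : Fin d) (w : List (Letter d)) :
      hol V (x + (P : ℤ) • e j) w = hol V x w := by
    induction w generalizing x with
    | nil => simp
    | cons l w ih =>
      rw [hol_cons, hol_cons, show x + (P : ℤ) • e j + l.vec = (x + l.vec) + (P : ℤ) • e j by abel, ih (x + l.vec)]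
      congr 1
      obtain ⟨μ, b⟩ := l
      cases b
      · rw [stepHol_false, stepHol_false, show x + (P : ℤ) • e j - e μ = (x - e μ) + (P : ℤ) • e j by abel, hV]
      · rw [stepHol_true, stepHol_true, hV]

end

end Summit.QuantumFields.BalabanUV.T4Continuum.NE3.FrameNormalisationAdmissible
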